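import Summits.QuantumFields.BalabanUV.T4Continuum.Support.CovariantVectorChartFactorisation

/-!
# T⁴ programme, SUBSTRATE (shared lattice-gauge analysis library) — THE FORM-RELATIVE EXPLICIT HOLOMORPHY RADIUS IN BAŁABAN's SCALING FORM:
# along the chart `(e^{A}R⁰, (R⁰)⁻¹e^{−A})` the two-sided operator keeps `γ/4`-coercivity for `‖A‖ < rho1`, `rho1 ≥ rhoStar(γ, d, a′, |o|)/n` —
# ONE inverse power of the level, level- and background-free prefactor (NE9 owner's request Q-S15, journal l.15770; typer NEXT gen 6 item 1(c))

Substrate cell `b2b-balaban-substrate-*`, seat p3.  The operator-norm modulus of the chart map is `≍ n²‖A‖` (the covariant derivative has norm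
`≍ 2n`), which only gives a radius `≍ γ/n²` — useless on Bałaban's domain `‖A‖ < α₁/n` (`NE9ChartRadiusScaling.not_holoRadiusCompat_sq`).  THIS FILE
takes the FORM-RELATIVE route: with `M_ν = siteMul (e^{A_ν})`, `N_ν = siteMul (e^{−A_ν})` one has the EXACT identities
`∇(e^{A}R⁰)_ν = M_ν·∇(R⁰)_ν + c·(M_ν − 1)`, `∇ᴬ((R⁰)⁻¹e^{−A})_ν = ∇(R⁰)_νᴴ·N_ν + c̄·(N_ν − 1)` and `N_ν·M_ν = 1`, so that
`∇ᴬ_ν·∇_ν = D_νᴴD_ν + c·D_νᴴN_ν(M_ν − 1) + c̄·(N_ν − 1)M_νD_ν + |c|²(N_ν − 1)(M_ν − 1)` (`D_ν = ∇(R⁰)_ν`): the unperturbed Gram term survives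
EXACTLY and the cross terms are absorbed into `½‖D_νv‖²` by Cauchy–Schwarz, at the cost `≍ d·n²·‖A‖²` — radius `≍ √γ/(√d·n)`; the averaging term is
handled in operator norm (`≍ a′|o|²·ℓ·‖A‖`, `ℓ ≍ (d+1)n` the contour length) — radius `≍ γ/(a′|o|²(d+1)·n)`.
 * (algebra and per-direction form bound: file `CovariantVectorChartFactorisation` — `cross_expand`, `re_term_ge`, `opNorm_avg_sub_le`);
 * §3 forms along the chart: `opNorm_Mfac_sub_one_le` ∕ `opNorm_Nfac_sub_one_le`, `Lnu`, **`re_form_dir_chart_ge`** (`Re ≥ ½‖∇_ν(R⁰)v‖² − Lν‖v‖²`),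
   **`re_form_covLapT_chart_ge`**, `mloss`, **`re_form_avg_chart_ge`**, `re_form_vecOp_eq` (`Re⟨v, vecOp v⟩ = Σ‖∇_ν(R⁰)v‖² + a′n^d‖Q(R⁰)v‖²`), `lossF`,
   **`coercive_deltaQT_chart`**: `Coercive (γ/2 − lossF n d a′ |o| ℓ ‖A‖) (deltaQT n (a′n^d) Γ (expChart R⁰ A) (expChartInv R⁰ A))`,
   `lossF = d·n²·δ²·(2(1+δ)² + 1) + a′·co·E·(2(2co+1) + co·E)`, `δ = t·e^t`, `E = (1+δ)^ℓ − 1`;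
 * §4 the radius **`rho1 n d a′ co ℓ γ = min (min ¼ (1/(3ℓ+1))) (min (√γ/(24√d·n + 1)) (γ/(384·a′·co²·ℓ + 1)))`**, `lossF_le_quarter`
   (`0 ≤ t < rho1 → lossF ≤ γ/4`), **`coercive_deltaQT_of_norm_lt_rho1`** (`Coercive (γ/4)`), **`isUnit_det_deltaQT_of_norm_lt_rho1`**,
   **`opNorm_greenT_le_of_norm_lt_rho1`** (`≤ 4/γ`), the SCALING FORM **`rhoStar_div_le_rho1`** (`ℓ ≤ (d+1)·n → rhoStar γ d a′ co / n ≤ rho1`,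
   `rhoStar = min (min ¼ (1/(3(d+1)+1))) (min (√γ/(24√d + 1)) (γ/(384·a′·co²·(d+1) + 1)))` LEVEL-FREE) and the tower junction
   **`inHoloBallT_rhoStar_subset_regularSetAt`** (standard-length contours at level `k`: `InHoloBallT P R⁰ (rhoStar/lev k) A →` regular `∧ ‖greenT‖ ≤ 4/γ`),
   `holoRadiusCompat_rhoStar` (`HoloRadiusCompat (k ↦ rhoStar/lev k) (k ↦ rho1 (lev k) …)` — the shape g32's `holoRadiusCompat_scaling_iff` compares).
Uniform over unitary `R⁰` (only `γ` enters); the level-free SMALLNESS `α₁ ≤ rhoStar` (NE9's S-class display) is NOT adjudicated here.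
HONEST FRAMING (T4-DAG p. 1).  Finite-dimensional linear algebra ([folklore]); no estimate of any NE row; nothing printed is a hypothesis; no
`def … : Prop`; spine 0/9 unchanged; NOT infinite volume ∕ mass gap ∕ Clay.  HONEST DEPENDENCY: continuum YM on T⁴ ⇐ BetaPertH ∧ nine spine estimates
(0/9 proved); BetaPertH ⇐ (D1) ∧ (D4) ∧ CAP+tail; G-an2-4 gates asym, D1 and NE2/3/4.  ABSOLUTE RULE kept; no `sorry`. -/

noncomputable section

open scoped BigOperators ComplexConjugate Matrix Matrix.Norms.L2Operator Kronecker ComplexOrder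

namespace Summit.QuantumFields.BalabanUV.T4Continuum.CovariantVectorCoerciveHoloForm

open Literature.MathematicalPhysics.QuantumFieldTheory.Balaban1983to89.B5Prop11Plancherel (Tor fine shiftM)
open Literature.MathematicalPhysics.QuantumFieldTheory.Balaban1983to89.B5Prop11Lower (nsq nsq_nonneg norm_star_dotProduct_le star_dotProduct_self)
open Literature.MathematicalPhysics.QuantumFieldTheory.Balaban1983to89.B5Action121 (star_mulVec_dotProduct)
open Summit.QuantumFields.BalabanUV.T4Continuum
open Summit.QuantumFields.BalabanUV.T4Continuum.BlockMultiplication (siteMul siteMul_sub siteMul_one siteMul_mul opNorm_siteMul_le)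
open Summit.QuantumFields.BalabanUV.T4Continuum.ColourCovariantLaplacian (covDc covLapC)
open Summit.QuantumFields.BalabanUV.T4Continuum.CovariantBlockAveraging (transport ContourSystem Qcov)
open Summit.QuantumFields.BalabanUV.T4Continuum.CoerciveInverseTower (Coercive isUnit_of_coercive opNorm_inv_le_of_coercive)
open Summit.QuantumFields.BalabanUV.T4Continuum.GaugeTermResolventBounds (re_form_gram)
open Summit.QuantumFields.BalabanUV.T4Continuum.GaugeTermCoercivity (abs_re_form_le)
open Summit.QuantumFields.BalabanUV.T4Continuum.CTWeightedEnergy (sqrt_nsq_mulVec_le)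
open Summit.QuantumFields.BalabanUV.T4Continuum.SubstrateTransporterSpecies
open Summit.QuantumFields.BalabanUV.T4Continuum.CovariantVectorCoercive (vecOp covLapC_eq_gram nsq_stackM_mulVec stackM)
open Summit.QuantumFields.BalabanUV.T4Continuum.CovariantVectorCoerciveHolo
open Summit.QuantumFields.BalabanUV.T4Continuum.CovariantVectorChartModulus

variable {d : ℕ} {o : Type*} [Fintype o] [DecidableEq o] [Nonempty o]

open Summit.QuantumFields.BalabanUV.T4Continuum.CovariantVectorChartFactorisation

/-! ## §3 The form-relative coercivity along the chart -/
section Chart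

variable (n : ℕ) [NeZero n] (M : Fin d → ℕ) [hM : ∀ μ, NeZero (M μ)]
variable {R₀ : Fin d → (Tor (fine n M) × Fin d → Matrix o o ℂ)}

/-- `‖M_ν − 1‖ ≤ ‖A‖e^{‖A‖}`. [folklore] -/
theorem opNorm_Mfac_sub_one_le (A : Fin d → (Tor (fine n M) × Fin d → Matrix o o ℂ)) (ν : Fin d) :
    ‖Mfac (fine n M) A ν - 1‖ ≤ ‖A‖ * Real.exp ‖A‖ := by
  rw [Mfac, ← siteMul_one, ← siteMul_sub]
  exact opNorm_siteMul_le _ (by positivity) fun i => norm_mexp_coord_sub_one_le A ν i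

/-- `‖N_ν − 1‖ ≤ ‖A‖e^{‖A‖}`. [folklore] -/
theorem opNorm_Nfac_sub_one_le (A : Fin d → (Tor (fine n M) × Fin d → Matrix o o ℂ)) (ν : Fin d) :
    ‖Nfac (fine n M) A ν - 1‖ ≤ ‖A‖ * Real.exp ‖A‖ := by
  rw [Nfac, ← siteMul_one, ← siteMul_sub]
  exact opNorm_siteMul_le _ (by positivity) fun i => norm_mexp_neg_coord_sub_one_le A ν i

omit [Nonempty o] in
/-- `‖X‖ ≤ 1 + ‖X − 1‖`. [folklore] -/
theorem opNorm_le_one_add {σ : Type*} [Fintype σ] [DecidableEq σ] [Nonempty σ] (X : Matrix σ σ ℂ) : ‖X‖ ≤ 1 + ‖X - 1‖ :=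
  (norm_le_insert' X 1).trans (by rw [norm_one])

/-- **THE PER-DIRECTION LOSS** `Lν n t = n²·δ²·(2(1 + δ)² + 1)`, `δ = t·e^t`. [folklore] -/
def Lnu (n : ℕ) (t : ℝ) : ℝ := (n : ℝ) ^ 2 * (t * Real.exp t) ^ 2 * (2 * (1 + t * Real.exp t) ^ 2 + 1)

/-- **PER-DIRECTION FORM INEQUALITY ALONG THE CHART**: `Re⟨v, ∇ᴬ_ν((R⁰)⁻¹e^{−A})·∇_ν(e^{A}R⁰) v⟩ ≥ ½‖∇_ν(R⁰)v‖² − Lν n ‖A‖·‖v‖²` for unitary `R⁰`.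
[folklore] -/
theorem re_form_dir_chart_ge (hR₀ : ∀ ν i, R₀ ν i ∈ Matrix.unitaryGroup o ℂ) (A : Fin d → (Tor (fine n M) × Fin d → Matrix o o ℂ)) (ν : Fin d)
    (v : (Tor (fine n M) × Fin d) × o → ℂ) :
    nsq (covDc (fine n M) ((n : ℕ) : ℂ) R₀ ν *ᵥ v) / 2 - Lnu n ‖A‖ * nsq v
      ≤ (star v ⬝ᵥ ((covDcA (fine n M) ((n : ℕ) : ℂ) (expChartInv R₀ A) ν * covDc (fine n M) ((n : ℕ) : ℂ) (expChart R₀ A) ν) *ᵥ v)).re := by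
  have hne : Nonempty ((Tor (fine n M) × Fin d) × o) := by
    rcases isEmpty_or_nonempty (Fin d) with hd | hd
    · exact (IsEmpty.false ν).elim
    · infer_instance
  set δ : ℝ := ‖A‖ * Real.exp ‖A‖ with hδdef
  have hδ : 0 ≤ δ := by positivity
  have hDa : covDcA (fine n M) ((n : ℕ) : ℂ) (fun μ i => (R₀ μ i)⁻¹) ν = (covDc (fine n M) ((n : ℕ) : ℂ) R₀ ν)ᴴ := by
    rw [← adjOf_eq_inv hR₀, covDcA_adjOf]
  have hM1 : ‖Mfac (fine n M) A ν - 1‖ ≤ δ := opNorm_Mfac_sub_one_le n M A ν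
  have hN1 : ‖Nfac (fine n M) A ν - 1‖ ≤ δ := opNorm_Nfac_sub_one_le n M A ν
  have hMn : ‖Mfac (fine n M) A ν‖ ≤ 1 + δ := (opNorm_le_one_add _).trans (by linarith)
  have hNn : ‖Nfac (fine n M) A ν‖ ≤ 1 + δ := (opNorm_le_one_add _).trans (by linarith)
  have hc : ‖((n : ℕ) : ℂ)‖ = n := Complex.norm_natCast n
  have hcc : ‖(starRingEnd ℂ) ((n : ℕ) : ℂ)‖ = n := by rw [Complex.norm_conj, hc]
  have hX : ‖Nfac (fine n M) A ν * (Mfac (fine n M) A ν - 1)‖ ≤ (1 + δ) * δ :=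
    (Matrix.l2_opNorm_mul _ _).trans (mul_le_mul hNn hM1 (norm_nonneg _) (by positivity))
  have hY : ‖(Nfac (fine n M) A ν - 1) * Mfac (fine n M) A ν‖ ≤ δ * (1 + δ) :=
    (Matrix.l2_opNorm_mul _ _).trans (mul_le_mul hN1 hMn (norm_nonneg _) hδ)
  have hK : ‖((n : ℕ) : ℂ)‖ * ‖Nfac (fine n M) A ν * (Mfac (fine n M) A ν - 1)‖
      + ‖(starRingEnd ℂ) ((n : ℕ) : ℂ)‖ * ‖(Nfac (fine n M) A ν - 1) * Mfac (fine n M) A ν‖ ≤ 2 * n * ((1 + δ) * δ) := by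
    rw [hc, hcc]
    nlinarith [mul_le_mul_of_nonneg_left hX (Nat.cast_nonneg n : (0 : ℝ) ≤ n), mul_le_mul_of_nonneg_left hY (Nat.cast_nonneg n : (0 : ℝ) ≤ n)]
  have hZ : ‖((starRingEnd ℂ) ((n : ℕ) : ℂ) * ((n : ℕ) : ℂ)) • ((Nfac (fine n M) A ν - 1) * (Mfac (fine n M) A ν - 1))‖ ≤ (n : ℝ) ^ 2 * δ ^ 2 := by
    rw [norm_smul, norm_mul, hc, hcc, sq, sq]
    exact mul_le_mul_of_nonneg_left ((Matrix.l2_opNorm_mul _ _).trans (mul_le_mul hN1 hM1 (norm_nonneg _) hδ)) (by positivity)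
  have h := re_term_ge (D := covDc (fine n M) ((n : ℕ) : ℂ) R₀ ν) hK hZ v
  rw [cross_expand, hDa]
  refine le_trans (le_of_eq ?_) h
  rw [Lnu, hδdef]; ring

/-- **THE LAPLACIAN FORM ALONG THE CHART**: `Re⟨v, Δ(e^{A}R⁰, (R⁰)⁻¹e^{−A}) v⟩ ≥ ½Σ_ν‖∇_ν(R⁰)v‖² − d·Lν n ‖A‖·‖v‖²`. [folklore] -/
theorem re_form_covLapT_chart_ge (hR₀ : ∀ ν i, R₀ ν i ∈ Matrix.unitaryGroup o ℂ) (A : Fin d → (Tor (fine n M) × Fin d → Matrix o o ℂ))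
    (v : (Tor (fine n M) × Fin d) × o → ℂ) :
    (∑ ν, nsq (covDc (fine n M) ((n : ℕ) : ℂ) R₀ ν *ᵥ v)) / 2 - d * Lnu n ‖A‖ * nsq v
      ≤ (star v ⬝ᵥ (covLapT (fine n M) ((n : ℕ) : ℂ) (expChart R₀ A) (expChartInv R₀ A) *ᵥ v)).re := by
  rw [covLapT, Matrix.sum_mulVec, dotProduct_sum, Complex.re_sum]
  have h := Finset.sum_le_sum fun ν (_ : ν ∈ (Finset.univ : Finset (Fin d))) => re_form_dir_chart_ge n M hR₀ A ν v
  refine le_trans (le_of_eq ?_) h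
  rw [Finset.sum_sub_distrib, Finset.sum_const, Finset.card_univ, Fintype.card_fin, nsmul_eq_mul, Finset.sum_div]
  ring

/-- **THE AVERAGING LOSS** `mloss a′ co ℓ t = a′·co·E·(2(2co + 1) + co·E)`, `E = Etr (t·e^t) ℓ`. [folklore] -/
def mloss (a' : ℝ) (co ℓ : ℕ) (t : ℝ) : ℝ := a' * co * Etr (t * Real.exp t) ℓ * (2 * (2 * co + 1) + co * Etr (t * Real.exp t) ℓ)

/-- **THE AVERAGING FORM ALONG THE CHART**: `Re⟨v, a·Qᴬ((R⁰)⁻¹e^{−A})Q(e^{A}R⁰) v⟩ ≥ a·n^{−d}… = a′‖Q(R⁰)v‖²·n^d − mloss·‖v‖²`, precisely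
`a′n^d·nsq(Q(R⁰)v) − mloss a′ |o| ℓ ‖A‖·nsq v ≤ Re⟨v, (a′n^d)·(QᴬQ)(chart) v⟩` (unitary `R⁰`, `a′ ≥ 0`, contours of length `≤ ℓ`). [folklore] -/
theorem re_form_avg_chart_ge (hR₀ : ∀ ν i, R₀ ν i ∈ Matrix.unitaryGroup o ℂ) (Γ : ContourSystem d n M) {ℓ : ℕ}
    (hΓ : ∀ y j μ (t : Fin n), (Γ y j μ t).length ≤ ℓ) {a' : ℝ} (ha' : 0 ≤ a') (A : Fin d → (Tor (fine n M) × Fin d → Matrix o o ℂ))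
    (v : (Tor (fine n M) × Fin d) × o → ℂ) :
    a' * (n : ℝ) ^ d * nsq (Qcov n M Γ R₀ *ᵥ v) - mloss a' (Fintype.card o) ℓ ‖A‖ * nsq v
      ≤ (star v ⬝ᵥ ((((a' * (n : ℝ) ^ d : ℝ) : ℂ) • (QcovA n M Γ (expChartInv R₀ A) * Qcov n M Γ (expChart R₀ A))) *ᵥ v)).re := by
  have hn : (0 : ℝ) < (n : ℝ) ^ d := pow_pos (by exact_mod_cast Nat.pos_of_ne_zero (NeZero.ne n)) d
  set δ : ℝ := ‖A‖ * Real.exp ‖A‖ with hδdef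
  have hδ : 0 ≤ δ := by positivity
  have hR' : ∀ ν i, ‖R₀ ν i‖ ≤ 1 := fun ν i => (norm_of_unitary (hR₀ ν i)).le
  have hS' : ∀ ν i, ‖adjOf R₀ ν i‖ ≤ 1 := fun ν i => by rw [adjOf_apply, Matrix.l2_opNorm_conjTranspose]; exact hR' ν i
  have hRR' : ∀ ν i, ‖expChart R₀ A ν i - R₀ ν i‖ ≤ δ := fun ν i => norm_expChart_sub_le hR₀ A ν i
  have hSS' : ∀ ν i, ‖expChartInv R₀ A ν i - adjOf R₀ ν i‖ ≤ δ := fun ν i => norm_expChartInv_sub_le hR₀ A ν i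
  -- the unperturbed form `a′n^d·‖Q(R⁰)v‖²`
  have h0 : (star v ⬝ᵥ ((((a' * (n : ℝ) ^ d : ℝ) : ℂ) • (QcovA n M Γ (adjOf R₀) * Qcov n M Γ R₀)) *ᵥ v)).re
      = a' * (n : ℝ) ^ d * nsq (Qcov n M Γ R₀ *ᵥ v) := by
    rw [QcovA_adjOf, Matrix.smul_mulVec, dotProduct_smul, smul_eq_mul, Complex.re_ofReal_mul, re_form_gram]
  -- the perturbation
  have hd : ‖QcovA n M Γ (expChartInv R₀ A) * Qcov n M Γ (expChart R₀ A) - QcovA n M Γ (adjOf R₀) * Qcov n M Γ R₀‖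
      ≤ ((n : ℝ) ^ d)⁻¹ * (Fintype.card o * Etr δ ℓ * (2 * (2 * Fintype.card o + 1) + Fintype.card o * Etr δ ℓ)) :=
    opNorm_avg_sub_le n M Γ hΓ hδ hR' hS' hRR' hSS'
  have hpert : |(star v ⬝ᵥ ((((a' * (n : ℝ) ^ d : ℝ) : ℂ) • (QcovA n M Γ (expChartInv R₀ A) * Qcov n M Γ (expChart R₀ A)
      - QcovA n M Γ (adjOf R₀) * Qcov n M Γ R₀)) *ᵥ v)).re| ≤ mloss a' (Fintype.card o) ℓ ‖A‖ * nsq v := by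
    refine (abs_re_form_le _ v).trans (mul_le_mul_of_nonneg_right ?_ (nsq_nonneg v))
    rw [norm_smul, Complex.norm_real, Real.norm_of_nonneg (by positivity : (0 : ℝ) ≤ a' * (n : ℝ) ^ d)]
    refine (mul_le_mul_of_nonneg_left hd (by positivity)).trans (le_of_eq ?_)
    rw [mloss, hδdef]; field_simp
  rw [abs_le] at hpert
  have hsplit : (((a' * (n : ℝ) ^ d : ℝ) : ℂ) • (QcovA n M Γ (expChartInv R₀ A) * Qcov n M Γ (expChart R₀ A)))
      = (((a' * (n : ℝ) ^ d : ℝ) : ℂ) • (QcovA n M Γ (adjOf R₀) * Qcov n M Γ R₀))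
        + (((a' * (n : ℝ) ^ d : ℝ) : ℂ) • (QcovA n M Γ (expChartInv R₀ A) * Qcov n M Γ (expChart R₀ A) - QcovA n M Γ (adjOf R₀) * Qcov n M Γ R₀)) := by
    rw [← smul_add, add_sub_cancel]
  rw [hsplit, Matrix.add_mulVec, dotProduct_add, Complex.add_re, h0]
  linarith [hpert.1]

omit [Nonempty o] in
/-- **THE FORM OF THE REAL SLICE**: `Re⟨v, vecOp v⟩ = Σ_ν‖∇_ν(R⁰)v‖² + a′n^d·‖Q(R⁰)v‖²`. [folklore] -/
theorem re_form_vecOp_eq (a' : ℝ) (Γ : ContourSystem d n M) (R : Fin d → (Tor (fine n M) × Fin d → Matrix o o ℂ))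
    (v : (Tor (fine n M) × Fin d) × o → ℂ) :
    (star v ⬝ᵥ (vecOp n M a' Γ R *ᵥ v)).re = (∑ ν, nsq (covDc (fine n M) ((n : ℕ) : ℂ) R ν *ᵥ v)) + a' * (n : ℝ) ^ d * nsq (Qcov n M Γ R *ᵥ v) := by
  rw [vecOp, covLapC_eq_gram, Matrix.add_mulVec, dotProduct_add, Complex.add_re, re_form_gram, nsq_stackM_mulVec, Matrix.smul_mulVec,
    dotProduct_smul, smul_eq_mul, Complex.re_ofReal_mul, re_form_gram]

/-- **THE TOTAL LOSS** `lossF n d a′ co ℓ t = d·Lν n t + mloss a′ co ℓ t`. [folklore] -/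
def lossF (n d : ℕ) (a' : ℝ) (co ℓ : ℕ) (t : ℝ) : ℝ := d * Lnu n t + mloss a' co ℓ t

/-- **FORM-RELATIVE COERCIVITY ALONG THE CHART**: for a unitary reference field with `γ`-coercive real slice, `a′ ≥ 0`, contours of length `≤ ℓ`:
`Coercive (γ/2 − lossF n d a′ |o| ℓ ‖A‖) (ΔQ_n(e^{A}R⁰, (R⁰)⁻¹e^{−A}))`. [folklore] -/
theorem coercive_deltaQT_chart (hR₀ : ∀ ν i, R₀ ν i ∈ Matrix.unitaryGroup o ℂ) (Γ : ContourSystem d n M) {ℓ : ℕ}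
    (hΓ : ∀ y j μ (t : Fin n), (Γ y j μ t).length ≤ ℓ) {a' γ : ℝ} (ha' : 0 ≤ a') (hco : Coercive γ (vecOp n M a' Γ R₀))
    (A : Fin d → (Tor (fine n M) × Fin d → Matrix o o ℂ)) :
    Coercive (γ / 2 - lossF n d a' (Fintype.card o) ℓ ‖A‖) (deltaQT n M ((n : ℕ) : ℂ) (a' * (n : ℝ) ^ d) Γ (expChart R₀ A) (expChartInv R₀ A)) := by
  intro v
  have hn : (0 : ℝ) < (n : ℝ) ^ d := pow_pos (by exact_mod_cast Nat.pos_of_ne_zero (NeZero.ne n)) d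
  have h1 := re_form_covLapT_chart_ge n M hR₀ A v
  have h2 := re_form_avg_chart_ge n M hR₀ Γ hΓ ha' A v
  have h3 := hco v
  rw [re_form_vecOp_eq] at h3
  have hQ0 : 0 ≤ a' * (n : ℝ) ^ d * nsq (Qcov n M Γ R₀ *ᵥ v) := mul_nonneg (by positivity) (nsq_nonneg _)
  have hD0 : 0 ≤ ∑ ν, nsq (covDc (fine n M) ((n : ℕ) : ℂ) R₀ ν *ᵥ v) := Finset.sum_nonneg fun ν _ => nsq_nonneg _
  rw [deltaQT, Matrix.add_mulVec, dotProduct_add, Complex.add_re, lossF]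
  nlinarith [nsq_nonneg v]

end Chart

/-! ## §4 The explicit radius in scaling form -/
section Radius

variable (n : ℕ) [NeZero n] (M : Fin d → ℕ) [hM : ∀ μ, NeZero (M μ)]

/-- **THE FORM-RELATIVE RADIUS** `rho1 n d a′ co ℓ γ = min (min ¼ (1/(3ℓ+1))) (min (√γ/(24√d·n + 1)) (γ/(384·a′·co²·ℓ + 1)))`. [folklore] -/
def rho1 (n d : ℕ) (a' : ℝ) (co ℓ : ℕ) (γ : ℝ) : ℝ :=
  min (min (1 / 4) (1 / (3 * (ℓ : ℝ) + 1))) (min (Real.sqrt γ / (24 * Real.sqrt d * n + 1)) (γ / (384 * a' * (co : ℝ) ^ 2 * ℓ + 1)))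

omit [Fintype o] [DecidableEq o] [Nonempty o] [NeZero n] hM in
/-- `rho1 > 0` for `γ > 0`, `a′ ≥ 0`. [folklore] -/
theorem rho1_pos {a' γ : ℝ} (ha' : 0 ≤ a') (hγ : 0 < γ) (co ℓ : ℕ) : 0 < rho1 n d a' co ℓ γ := by
  unfold rho1
  exact lt_min (lt_min (by norm_num) (by positivity)) (lt_min (by positivity) (by positivity))

omit [Fintype o] [DecidableEq o] [Nonempty o] [NeZero n] hM in
/-- **inside `rho1` the loss is at most `γ/4`** (`e^t ≤ 3`, `δ ≤ 3t ≤ ¾`, `2(1+δ)² + 1 ≤ 8`, `576·d·n²·t² ≤ γ`; `ℓδ ≤ 1`, `E ≤ 2ℓδ ≤ 6ℓt`, `E ≤ 2`).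
[folklore] -/
theorem lossF_le_quarter {a' γ t : ℝ} (ha' : 0 ≤ a') (hγ : 0 < γ) {co : ℕ} (hco : 1 ≤ co) (ℓ : ℕ) (ht0 : 0 ≤ t)
    (ht : t < rho1 n d a' co ℓ γ) : lossF n d a' co ℓ t ≤ γ / 4 := by
  have hℓ : (0 : ℝ) ≤ ℓ := Nat.cast_nonneg _
  have hco1 : (1 : ℝ) ≤ co := by exact_mod_cast hco
  have hd0 : (0 : ℝ) ≤ d := Nat.cast_nonneg _
  have hn0 : (0 : ℝ) ≤ n := Nat.cast_nonneg _
  have ht4 : t ≤ 1 / 4 := ht.le.trans ((min_le_left _ _).trans (min_le_left _ _))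
  have ht1 : t ≤ 1 / (3 * (ℓ : ℝ) + 1) := ht.le.trans ((min_le_left _ _).trans (min_le_right _ _))
  have ht2 : t ≤ Real.sqrt γ / (24 * Real.sqrt d * n + 1) := ht.le.trans ((min_le_right _ _).trans (min_le_left _ _))
  have ht3 : t ≤ γ / (384 * a' * (co : ℝ) ^ 2 * ℓ + 1) := ht.le.trans ((min_le_right _ _).trans (min_le_right _ _))
  -- `e^t ≤ 3`, `δ ≤ 3t ≤ 3/4`
  have he : Real.exp t ≤ 3 := (Real.exp_le_exp.mpr (by linarith : t ≤ 1)).trans (by have := Real.exp_one_lt_d9; norm_num at this ⊢; linarith)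
  set δ := t * Real.exp t with hδdef
  have hδ0 : 0 ≤ δ := by positivity
  have hδ3 : δ ≤ 3 * t := by rw [hδdef, mul_comm]; exact mul_le_mul_of_nonneg_right he ht0
  have hδ34 : δ ≤ 3 / 4 := by linarith
  -- Laplacian part: `d·Lν ≤ 72·d·n²·t² ≤ γ/8`
  have hsq : 576 * d * (n : ℝ) ^ 2 * t ^ 2 ≤ γ := by
    have hden : 0 < 24 * Real.sqrt d * n + 1 := by positivity
    have h1 : t * (24 * Real.sqrt d * n + 1) ≤ Real.sqrt γ := by rwa [le_div_iff₀ hden] at ht2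
    have h2 : 24 * Real.sqrt d * n * t ≤ Real.sqrt γ := by nlinarith
    have h3 : 0 ≤ 24 * Real.sqrt d * n * t := by positivity
    have h4 := mul_le_mul h2 h2 h3 (Real.sqrt_nonneg _)
    rw [Real.mul_self_sqrt hγ.le] at h4
    have hsd : Real.sqrt d * Real.sqrt d = d := Real.mul_self_sqrt hd0
    have heq : 24 * Real.sqrt d * n * t * (24 * Real.sqrt d * n * t) = 576 * (Real.sqrt d * Real.sqrt d) * (n : ℝ) ^ 2 * t ^ 2 := by ring
    rw [hsd] at heq
    rw [heq] at h4
    exact h4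
  have hA : (d : ℝ) * Lnu n t ≤ γ / 8 := by
    have hbr : 2 * (1 + δ) ^ 2 + 1 ≤ 8 := by nlinarith
    have hL : Lnu n t ≤ (n : ℝ) ^ 2 * (3 * t) ^ 2 * 8 := by
      unfold Lnu
      rw [← hδdef]
      exact mul_le_mul (mul_le_mul_of_nonneg_left (pow_le_pow_left₀ hδ0 hδ3 2) (by positivity)) hbr (by positivity) (by positivity)
    calc (d : ℝ) * Lnu n t ≤ d * ((n : ℝ) ^ 2 * (3 * t) ^ 2 * 8) := mul_le_mul_of_nonneg_left hL hd0
      _ = (576 * d * (n : ℝ) ^ 2 * t ^ 2) / 8 := by ring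
      _ ≤ γ / 8 := by linarith
  -- averaging part: `mloss ≤ 48·a′·co²·ℓ·t ≤ γ/8`
  have hℓδ : (ℓ : ℝ) * δ ≤ 1 := by
    have h1 : (ℓ : ℝ) * δ ≤ ℓ * (3 * t) := mul_le_mul_of_nonneg_left hδ3 hℓ
    have h2 : (3 * (ℓ : ℝ) + 1) * t ≤ 1 := by rwa [le_div_iff₀ (by positivity), mul_comm] at ht1
    nlinarith
  have hE : Etr δ ℓ ≤ 2 * (ℓ * δ) := by
    have hpow : (1 + δ) ^ ℓ ≤ Real.exp (ℓ * δ) := by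
      rw [Real.exp_nat_mul]; exact pow_le_pow_left₀ (by linarith) (by linarith [Real.add_one_le_exp δ]) ℓ
    have habs : |Real.exp (ℓ * δ) - 1| ≤ 2 * |(ℓ : ℝ) * δ| := Real.abs_exp_sub_one_le (by rw [abs_of_nonneg (by positivity)]; exact hℓδ)
    rw [abs_of_nonneg (by positivity : (0 : ℝ) ≤ ℓ * δ)] at habs
    have := (le_abs_self _).trans habs
    show (1 + δ) ^ ℓ - 1 ≤ 2 * (ℓ * δ)
    linarith
  have hE0 : 0 ≤ Etr δ ℓ := Etr_nonneg hδ0 ℓ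
  have hE6 : Etr δ ℓ ≤ 6 * ℓ * t := hE.trans (by nlinarith)
  have hE2 : Etr δ ℓ ≤ 2 := hE.trans (by nlinarith)
  have hB : mloss a' co ℓ t ≤ γ / 8 := by
    have hbr : 2 * (2 * (co : ℝ) + 1) + co * Etr δ ℓ ≤ 8 * co := by nlinarith
    have hbr0 : 0 ≤ 2 * (2 * (co : ℝ) + 1) + co * Etr δ ℓ := add_nonneg (by positivity) (mul_nonneg (by positivity) hE0)
    have hm : mloss a' co ℓ t ≤ 48 * a' * (co : ℝ) ^ 2 * ℓ * t := by
      unfold mloss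
      rw [← hδdef]
      calc a' * co * Etr δ ℓ * (2 * (2 * co + 1) + co * Etr δ ℓ) = (a' * co) * (Etr δ ℓ * (2 * (2 * co + 1) + co * Etr δ ℓ)) := by ring
        _ ≤ (a' * co) * ((6 * ℓ * t) * (8 * co)) := mul_le_mul_of_nonneg_left (mul_le_mul hE6 hbr hbr0 (by positivity)) (by positivity)
        _ = 48 * a' * (co : ℝ) ^ 2 * ℓ * t := by ring
    have hden : 0 < 384 * a' * (co : ℝ) ^ 2 * ℓ + 1 := by positivity
    have h2 : (48 * a' * (co : ℝ) ^ 2 * ℓ) * t ≤ γ / 8 := by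
      refine (mul_le_mul_of_nonneg_left ht3 (by positivity)).trans ?_
      rw [mul_div_assoc', div_le_div_iff₀ hden (by norm_num : (0 : ℝ) < 8)]
      nlinarith
    linarith
  unfold lossF
  linarith

variable {R₀ : Fin d → (Tor (fine n M) × Fin d → Matrix o o ℂ)}

/-- **`γ/4`-COERCIVITY INSIDE `rho1`**. [folklore] -/
theorem coercive_deltaQT_of_norm_lt_rho1 (hR₀ : ∀ ν i, R₀ ν i ∈ Matrix.unitaryGroup o ℂ) (Γ : ContourSystem d n M) {ℓ : ℕ}
    (hΓ : ∀ y j μ (t : Fin n), (Γ y j μ t).length ≤ ℓ) {a' γ : ℝ} (ha' : 0 ≤ a') (hco : Coercive γ (vecOp n M a' Γ R₀)) (hγ : 0 < γ)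
    {A : Fin d → (Tor (fine n M) × Fin d → Matrix o o ℂ)} (hA : ‖A‖ < rho1 n d a' (Fintype.card o) ℓ γ) :
    Coercive (γ / 4) (deltaQT n M ((n : ℕ) : ℂ) (a' * (n : ℝ) ^ d) Γ (expChart R₀ A) (expChartInv R₀ A)) := by
  intro v
  have h := coercive_deltaQT_chart n M hR₀ Γ hΓ ha' hco A v
  have hl := lossF_le_quarter n (d := d) ha' hγ (Fintype.card_pos (α := o)) ℓ (norm_nonneg A) hA
  nlinarith [nsq_nonneg v]

/-- **EXPLICIT INVERTIBILITY INSIDE `rho1`**. [folklore] -/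
theorem isUnit_det_deltaQT_of_norm_lt_rho1 (hR₀ : ∀ ν i, R₀ ν i ∈ Matrix.unitaryGroup o ℂ) (Γ : ContourSystem d n M) {ℓ : ℕ}
    (hΓ : ∀ y j μ (t : Fin n), (Γ y j μ t).length ≤ ℓ) {a' γ : ℝ} (ha' : 0 ≤ a') (hco : Coercive γ (vecOp n M a' Γ R₀)) (hγ : 0 < γ)
    {A : Fin d → (Tor (fine n M) × Fin d → Matrix o o ℂ)} (hA : ‖A‖ < rho1 n d a' (Fintype.card o) ℓ γ) :
    IsUnit (deltaQT n M ((n : ℕ) : ℂ) (a' * (n : ℝ) ^ d) Γ (expChart R₀ A) (expChartInv R₀ A)).det :=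
  (Matrix.isUnit_iff_isUnit_det _).mp (isUnit_of_coercive (by positivity) (coercive_deltaQT_of_norm_lt_rho1 n M hR₀ Γ hΓ ha' hco hγ hA))

/-- **`‖greenT‖ ≤ 4/γ` INSIDE `rho1`**. [folklore] -/
theorem opNorm_greenT_le_of_norm_lt_rho1 (hR₀ : ∀ ν i, R₀ ν i ∈ Matrix.unitaryGroup o ℂ) (Γ : ContourSystem d n M) {ℓ : ℕ}
    (hΓ : ∀ y j μ (t : Fin n), (Γ y j μ t).length ≤ ℓ) {a' γ : ℝ} (ha' : 0 ≤ a') (hco : Coercive γ (vecOp n M a' Γ R₀)) (hγ : 0 < γ)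
    {A : Fin d → (Tor (fine n M) × Fin d → Matrix o o ℂ)} (hA : ‖A‖ < rho1 n d a' (Fintype.card o) ℓ γ) :
    ‖greenT n M ((n : ℕ) : ℂ) (a' * (n : ℝ) ^ d) Γ (expChart R₀ A) (expChartInv R₀ A)‖ ≤ 4 / γ := by
  rw [greenT, show (4 : ℝ) / γ = (γ / 4)⁻¹ by rw [inv_div]]
  exact opNorm_inv_le_of_coercive (by positivity) (coercive_deltaQT_of_norm_lt_rho1 n M hR₀ Γ hΓ ha' hco hγ hA)

/-- **THE LEVEL-FREE PREFACTOR** `rhoStar γ d a′ co = min (min ¼ (1/(3(d+1)+1))) (min (√γ/(24√d + 1)) (γ/(384·a′·co²·(d+1) + 1)))`. [folklore] -/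
def rhoStar (γ : ℝ) (d : ℕ) (a' : ℝ) (co : ℕ) : ℝ :=
  min (min (1 / 4) (1 / (3 * ((d : ℝ) + 1) + 1))) (min (Real.sqrt γ / (24 * Real.sqrt d + 1)) (γ / (384 * a' * (co : ℝ) ^ 2 * ((d : ℝ) + 1) + 1)))

omit [Fintype o] [DecidableEq o] [Nonempty o] [NeZero n] hM in
/-- `rhoStar > 0`. [folklore] -/
theorem rhoStar_pos {a' γ : ℝ} (ha' : 0 ≤ a') (hγ : 0 < γ) (co : ℕ) : 0 < rhoStar γ d a' co := by
  unfold rhoStar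
  exact lt_min (lt_min (by norm_num) (by positivity)) (lt_min (by positivity) (by positivity))

omit [Fintype o] [DecidableEq o] [Nonempty o] [NeZero n] hM in
/-- **SCALING FORM**: for contours of length `ℓ ≤ (d+1)·n` (the standard ones) the radius is at least `rhoStar/n` — ONE inverse power of the level,
level- and background-free prefactor. [folklore] -/
theorem rhoStar_div_le_rho1 {a' γ : ℝ} (ha' : 0 ≤ a') (hγ : 0 < γ) (co : ℕ) {ℓ : ℕ} (hn : 1 ≤ n) (hℓ : (ℓ : ℝ) ≤ ((d : ℝ) + 1) * n) :
    rhoStar γ d a' co / n ≤ rho1 n d a' co ℓ γ := by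
  have hn1 : (1 : ℝ) ≤ n := by exact_mod_cast hn
  have hn0 : (0 : ℝ) < n := by linarith
  have hρ0 : 0 < rhoStar γ d a' co := rhoStar_pos (d := d) ha' hγ co
  have hρ4 : rhoStar γ d a' co ≤ 1 / 4 := (min_le_left _ _).trans (min_le_left _ _)
  have hρd : rhoStar γ d a' co ≤ 1 / (3 * ((d : ℝ) + 1) + 1) := (min_le_left _ _).trans (min_le_right _ _)
  have hρs : rhoStar γ d a' co ≤ Real.sqrt γ / (24 * Real.sqrt d + 1) := (min_le_right _ _).trans (min_le_left _ _)
  have hρm : rhoStar γ d a' co ≤ γ / (384 * a' * (co : ℝ) ^ 2 * ((d : ℝ) + 1) + 1) := (min_le_right _ _).trans (min_le_right _ _)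
  have hdiv : rhoStar γ d a' co / n ≤ rhoStar γ d a' co := div_le_self hρ0.le hn1
  have hco0 : (0 : ℝ) ≤ (co : ℝ) ^ 2 := sq_nonneg _
  unfold rho1
  refine le_min (le_min (hdiv.trans hρ4) ?_) (le_min ?_ ?_)
  · -- `ρ⋆/n ≤ 1/(3ℓ+1)`
    calc rhoStar γ d a' co / n ≤ 1 / (3 * ((d : ℝ) + 1) + 1) / n := div_le_div_of_nonneg_right hρd hn0.le
      _ = 1 / ((3 * ((d : ℝ) + 1) + 1) * n) := by rw [div_div]
      _ ≤ 1 / (3 * (ℓ : ℝ) + 1) := one_div_le_one_div_of_le (by positivity) (by nlinarith)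
  · -- `ρ⋆/n ≤ √γ/(24√d·n + 1)`
    calc rhoStar γ d a' co / n ≤ Real.sqrt γ / (24 * Real.sqrt d + 1) / n := div_le_div_of_nonneg_right hρs hn0.le
      _ = Real.sqrt γ / ((24 * Real.sqrt d + 1) * n) := by rw [div_div]
      _ ≤ Real.sqrt γ / (24 * Real.sqrt d * n + 1) :=
          div_le_div_of_nonneg_left (Real.sqrt_nonneg _) (by positivity) (by nlinarith [Real.sqrt_nonneg (d : ℝ)])
  · -- `ρ⋆/n ≤ γ/(384·a′·co²·ℓ + 1)`
    calc rhoStar γ d a' co / n ≤ γ / (384 * a' * (co : ℝ) ^ 2 * ((d : ℝ) + 1) + 1) / n := div_le_div_of_nonneg_right hρm hn0.le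
      _ = γ / ((384 * a' * (co : ℝ) ^ 2 * ((d : ℝ) + 1) + 1) * n) := by rw [div_div]
      _ ≤ γ / (384 * a' * (co : ℝ) ^ 2 * ℓ + 1) := by
          refine div_le_div_of_nonneg_left hγ.le (by positivity) ?_
          have h1 : 384 * a' * (co : ℝ) ^ 2 * ℓ ≤ 384 * a' * (co : ℝ) ^ 2 * (((d : ℝ) + 1) * n) :=
            mul_le_mul_of_nonneg_left hℓ (by positivity)
          nlinarith

end Radius

/-! ### The tower junction in scaling form -/
section Tower

open Literature.MathematicalPhysics.QuantumFieldTheory.Balaban1983to89 (Params)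
open Summit.QuantumFields.BalabanUV.T4Continuum.SubstrateBackgroundTransporters (unitMod)
open Literature.MathematicalPhysics.QuantumFieldTheory.Balaban1983to89.B5G183RateUnitTower (lev lev_neZero)
open Summit.QuantumFields.BalabanUV.T4Continuum.SubstrateTransporterSpeciesHolo (expChartT expChartInvT regularSetAt)

/-- **THE EXPLICIT LEVEL JUNCTION IN SCALING FORM**: at NE2 level `k` (letters `c = lev k`, `a = a′·(lev k)^d`), for a unitary reference field with
`γ`-coercive real slice and contours of length `≤ (d+1)·lev k`, the tower ball `InHoloBallT P R⁰ (rhoStar γ d a′ |o| / lev k)` consists of regular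
chart points with `‖greenT‖ ≤ 4/γ` — the radius NE9 displays as `D.R ≤ rhoStar/lev k`. [folklore] -/
theorem inHoloBallT_rhoStar_subset_regularSetAt (P : Params) (Γ : (k : ℕ) → ContourSystem P.d (lev P.L k) (unitMod P)) {R₀ : TowerData P o}
    (k : Fin (P.K + 1)) {ℓ : ℕ} (hΓ : ∀ y j μ (t : Fin (lev P.L k)), (Γ k y j μ t).length ≤ ℓ) (hℓ : (ℓ : ℝ) ≤ ((P.d : ℝ) + 1) * (lev P.L k : ℕ))
    (hR₀ : ∀ ν i, R₀ k ν i ∈ Matrix.unitaryGroup o ℂ) {a' γ : ℝ} (ha' : 0 ≤ a') (hco : Coercive γ (vecOp (lev P.L k) (unitMod P) a' (Γ k) (R₀ k)))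
    (hγ : 0 < γ) {A : TowerData P o} (hA : InHoloBallT P R₀ (rhoStar γ P.d a' (Fintype.card o) / (lev P.L k : ℕ)) A) :
    A ∈ regularSetAt P (((lev P.L k : ℕ) : ℂ)) (a' * ((lev P.L k : ℕ) : ℝ) ^ P.d) Γ R₀ k ∧
      ‖greenT (lev P.L k) (unitMod P) (((lev P.L k : ℕ) : ℂ)) (a' * ((lev P.L k : ℕ) : ℝ) ^ P.d) (Γ k) (expChartT P R₀ A k) (expChartInvT P R₀ A k)‖
        ≤ 4 / γ := by
  have hn : 1 ≤ (lev P.L k : ℕ) := Nat.one_le_iff_ne_zero.mpr (NeZero.ne _)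
  have hAk : ‖A k‖ < rho1 (lev P.L k) P.d a' (Fintype.card o) ℓ γ :=
    lt_of_lt_of_le (inHoloBallT_apply P hA k) (rhoStar_div_le_rho1 (lev P.L k) (d := P.d) ha' hγ (Fintype.card o) hn hℓ)
  exact ⟨isUnit_det_deltaQT_of_norm_lt_rho1 (lev P.L k) (unitMod P) hR₀ (Γ k) hΓ ha' hco hγ hAk,
    opNorm_greenT_le_of_norm_lt_rho1 (lev P.L k) (unitMod P) hR₀ (Γ k) hΓ ha' hco hγ hAk⟩

/-- **`HoloRadiusCompat` IN SCALING FORM** (the shape g32's `holoRadiusCompat_scaling_iff` compares): level by level, the scaling-form radii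
`rhoStar/lev k` sit inside the form-relative radii `rho1 (lev k) …` whenever the level-`k` contours have length `≤ (d+1)·lev k`. [folklore] -/
theorem holoRadiusCompat_rhoStar (P : Params) {a' γ : ℝ} (ha' : 0 ≤ a') (hγ : 0 < γ) (co : ℕ) (ℓ : Fin (P.K + 1) → ℕ)
    (hℓ : ∀ k, (ℓ k : ℝ) ≤ ((P.d : ℝ) + 1) * (lev P.L k : ℕ)) :
    HoloRadiusCompat (fun k : Fin (P.K + 1) => rhoStar γ P.d a' co / (lev P.L k : ℕ)) (fun k => rho1 (lev P.L k) P.d a' co (ℓ k) γ) :=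
  fun k => rhoStar_div_le_rho1 (lev P.L k) (d := P.d) ha' hγ co (Nat.one_le_iff_ne_zero.mpr (NeZero.ne _)) (hℓ k)

end Tower

end Summit.QuantumFields.BalabanUV.T4Continuum.CovariantVectorCoerciveHoloForm

end
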